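import Summits.ResolutionOfSingularities.ResolutionOfSingularities.Theorems.JetCutJetKernels2
import HarnessLib

/-!
# JetCutJetKernels3 — decomp-res node «JetCut» (lens-2 g15 rev 5), file 3/4 of `JetCutJetKernels`

Content VERBATIM from the decomp-res lens-2 file `HOME/decomp-res-lens-2/g15/JetCut.lean` rev 5 (pin 9f53e5ca =
`parts/JetCut-rev5-9f53e5ca.lean`, 7 495 l;
HOME = run/shared/lean/pub/decomp-res; CRITIC-LEDGER rows 109 / 115 / 120 / 121 / 122 / 127 / 133 CLEARED; landing
order INBOX :231; the critic's
HYGIENE-landing.md h1–h11 applied — DOCSTRING-ONLY).  The lens's blocks RESTATED VERBATIM from lens-2 g12 / g13 /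
g14 (§R / §R13 / §R14) are DELETED:
they are the tree's `RelativeDeltaCut*` / `CurveLeafExit*` / `PinchCut*` modules (namespaces `RelativeDeltaCut`,
`CurveLeafExit`, `PinchCut`, opened;
the lens's `CurveLeafExitRestated.x` / `PinchCutRestated.x` are cited as `CurveLeafExit.x` / `PinchCut.x`, the three
pointwise engine edges of g12 as
`RelativeDeltaCut.x`).  Namespace `…Theorems.JetCut` (the lens's `Theses.JetCut` is gate-reserved), sub-namespaces
`Tame` / `Wide` / `Broad` / `Vast`
as in the lens; file split only (tree files ≤ 400 lines): sections, variables and every declaration exactly as in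
the lens, the long rev-0/1 prose
lives in HOME/decomp-res-lens-2/g15/NODE-g15.md §ARCHIVE-A (not in the tree).  Node files, in import order:
`JetCutJetKernels`, `JetCutPoint`, `JetCutClasses`, `JetCutKernels`, `JetCutTame`, `JetCutTameClasses`,
`JetCutTameKernels`, `JetCutLadder`, `JetCutWideClasses`, `JetCutWideKernels`, `JetCutMixed`, `JetCutBroadClasses`,
`JetCutBroadKernels`, `JetCutDegenerate`, `JetCutVastClasses`, `JetCutVastKernels`
(each possibly continued `…2`, `…3`), then the wiring `MaxContactCutJetCut*` (in the Theses cone).  All `--supports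
stmt-ResolutionOfSingularities-29273`
(`MaxContactCut.RungOne`); nothing closes 29273 — decided cells carry their engines as hypotheses, and exactly ONE
located-residual aside is booked on
the route for this column (`Vast.VastSpecialRung`, home `JetCutVastClasses`).

§J1 + §J1b: RING LEVEL of the jet test — the chart relations `chartRel` of the blow-up algebra of a regular
sequence, the ONE-STEP test `JetShallow`, and its KERNELS over an arbitrary commutative ring: representability of
`(c)^{m+1}` by forms, **`jetShallow_of_coneShallow`** ((C) ⊆ (J), PROVED), `not_jetShallow_zero` (quantifier-shape
sanity), the typed (CT) test `ConeTailShallow`, the regularity port `ExcParamRegular`,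
**`jetShallow_of_coneTailShallow`** ((CT) ⊆ (J) modulo the port, PROVED).

Part 3/4 carries: `ExcParamRegular`, `coneTailShallow_of_coneShallow`, `exists_form_of_mem_mul_span_pow`.

(Sources: HunekeSwanson2006 Cor. 5.5.5; CossartJannsenSaito2020 Ch. 2, Thm. 3.6/3.7, Ch. 8; CossartPiltant2008 Prop.
4.2; CossartPiltant2019 Rem. 3.2; Hironaka1964 Ch. III; Hironaka1967; Hironaka1977; Moh1987; Giraud1975.)
-/

open CategoryTheory AlgebraicGeometry TopologicalSpace IsLocalRing
open Literature.AlgebraicGeometry.Resolution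
open Summit.ResolutionOfSingularities.ResolutionOfSingularities.Theorems
open Summit.ResolutionOfSingularities.ResolutionOfSingularities.Theorems.WeakOrderReduction
open Summit.ResolutionOfSingularities.ResolutionOfSingularities.Theorems.DeltaFaceCutClasses
open Summit.ResolutionOfSingularities.ResolutionOfSingularities.Theorems.RelativeDeltaCut
open Summit.ResolutionOfSingularities.ResolutionOfSingularities.Theorems.CurveLeafExit
open Summit.ResolutionOfSingularities.ResolutionOfSingularities.Theorems.PinchCut

namespace Summit.ResolutionOfSingularities.ResolutionOfSingularities.Theorems.JetCut

section JetKernels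

variable {R : Type} [CommRing R] {d : ℕ}

/-- [rev 1] **Typed regularity port of the exceptional parameter** (`ExcParamRegular M c v`): at every closed point `x'` of
the chart-`u_j` exceptional fibre lying on `{z/u_j = 0}` (`𝔐 ∋ X₀`), the exceptional parameter `u_j` is not a zero
divisor modulo `(X₀, v) + 𝔐²` in the chart ring:  `u_j·T ∈ chartRel + 𝔐² + (X₀) + (v) ⟹ T ∈ 𝔐`.  TRUE
(EXACT-ON-PAPER) whenever `R` is regular local with regular system of parameters `(c, v)`: then `𝒪_{Y₁,x'} =
(R[X]/chartRel)_𝔐` is regular with `u_j, X₀, v` part of a regular system of parameters, so `ū_j` is independent of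
`X̄₀, v̄` in `𝔪_{x'}/𝔪²_{x'}` [HunekeSwanson2006 Cor. 5.5.5 (linear type); regularity of blow-ups of regular centres].
It mentions neither the ideal `J` nor the presentation: a HYPOTHESIS-level regularity certificate on `(𝔪, c, v)` alone
(not provable over an arbitrary ring: false for `c_j = 0`; probe P32), the ONE paper ingredient of the (CT) tail
branch made explicit.  DEFINITION (typed port, EXACT-ON-PAPER at regular points). -/
def ExcParamRegular (M : Ideal R) (c : Fin (d + 1) → R) (v : R) : Prop :=
  ∀ (i : Fin d) (Q : Ideal (MvPolynomial (Fin (d + 1)) R)), Q.IsMaximal →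
    Ideal.map (MvPolynomial.C : R →+* MvPolynomial (Fin (d + 1)) R) M ≤ Q →
    (MvPolynomial.X i.succ : MvPolynomial (Fin (d + 1)) R) ∈ Q →
    (MvPolynomial.X 0 : MvPolynomial (Fin (d + 1)) R) ∈ Q →
    ∀ T : MvPolynomial (Fin (d + 1)) R,
      MvPolynomial.C (c i.succ) * T ∈
        chartRel c i.succ ⊔ Q ^ 2 ⊔ Ideal.span {(MvPolynomial.X 0 : MvPolynomial (Fin (d + 1)) R)} ⊔
          Ideal.span {(MvPolynomial.C v : MvPolynomial (Fin (d + 1)) R)} →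
      T ∈ Q

/-- [rev 1] (C) ⊆ (CT) by letter for a normalised presentation `Φ = v·Ψ` (the cone branch alone). [folklore] -/
theorem coneTailShallow_of_coneShallow {P : Ideal R} {v : R} {Ψ : MvPolynomial (Fin d) R}
    (γ : Fin d → MvPolynomial (Fin d) R) {n : ℕ} (h : ConeShallow P v (MvPolynomial.C v * Ψ) n) :
    ConeTailShallow P v Ψ γ n :=
  fun j N hN hv hX => Or.inl (h j N hN hv hX)

/-- Representability with a coefficient ideal: an element of `𝔞·(c)^m` is the value at `c` of a degree-`m` form with
coefficients in `𝔞`. [folklore] -/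
theorem exists_form_of_mem_mul_span_pow {k : ℕ} (c : Fin k → R) (𝔞 : Ideal R) (m : ℕ) {g : R}
    (hg : g ∈ 𝔞 * Ideal.span (Set.range c) ^ m) :
    ∃ G : MvPolynomial (Fin k) R, G.IsHomogeneous m ∧ (∀ β, G.coeff β ∈ 𝔞) ∧ MvPolynomial.eval c G = g := by
  classical
  induction m generalizing g with
  | zero =>
    rw [pow_zero, mul_one] at hg
    refine ⟨MvPolynomial.C g, MvPolynomial.isHomogeneous_C _ _, ?_, by simp⟩
    intro β
    rw [MvPolynomial.coeff_C]
    split_ifs with h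
    · exact hg
    · exact Ideal.zero_mem _
  | succ m ih =>
    rw [pow_succ, ← mul_assoc] at hg
    refine Submodule.mul_induction_on hg ?_ ?_
    · intro a ha b hb
      obtain ⟨G, hGh, hGc, hGe⟩ := ih ha
      obtain ⟨r, hr⟩ := Ideal.mem_span_range_iff_exists_fun.1 hb
      refine ⟨G * ∑ i, MvPolynomial.C (r i) * MvPolynomial.X i, ?_, ?_, ?_⟩
      · refine hGh.mul ?_
        refine MvPolynomial.IsHomogeneous.sum _ _ _ ?_
        intro i _
        simpa using (MvPolynomial.isHomogeneous_C _ (r i)).mul (MvPolynomial.isHomogeneous_X R i)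
      · intro β
        rw [MvPolynomial.coeff_mul]
        refine Ideal.sum_mem _ ?_
        intro x _
        exact Ideal.mul_mem_right _ _ (hGc x.1)
      · simp [hGe, hr]
    · rintro x y ⟨Gx, hx1, hx2, hx3⟩ ⟨Gy, hy1, hy2, hy3⟩
      refine ⟨Gx + Gy, hx1.add hy1, fun β => ?_, by simp [hx3, hy3]⟩
      rw [MvPolynomial.coeff_add]
      exact Ideal.add_mem _ (hx2 β) (hy2 β)

end JetKernels

end Summit.ResolutionOfSingularities.ResolutionOfSingularities.Theorems.JetCut
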